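import Literature.MathematicalPhysics.QuantumFieldTheory.O2ScanObligations
import Literature.MathematicalPhysics.QuantumFieldTheory.O2WardObligations
import HarnessLib

/-!
# The obligation list of an `O(2)` scan functional with Ward-directed stress tensor and current

Topic: `Literature/MathematicalPhysics/QuantumFieldTheory` (conformal bootstrap; verifier-B / `certsdp` client path
of the ENGINES group).  HONEST FRAMING: shared numerical engines serving client cells; rigour lives in the verifiers;
every published number belongs to a client cell's ledger, not to the engines group.  A Literature module: published
statements re-proved in the kernel over the tree's own objects — no named facts, no `sorry`, nothing numerical.

`O2ScanObligations` lists, for ONE scan functional at ONE external point, the `l`-independent functional conditions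
of Chester–Landry–Liu–Poland–Simmons-Duffin–Su–Vichi, *Carving out OPE space and precise O(2) model critical
exponents*, JHEP 06 (2020) 142 [ChesterEtAl2020], §3.1, against the spectrum assumptions of §2.2, and assembles box
exclusion under the axioms A1–A4 of `O2ThreeScalarSystem`.  Two items of that list — `stress_0p : Pos0p α D 3 2` and
`current_0m : Pos0m α D 2 1`, positive SEMI-definiteness of `α(V⃗_{0⁺})` at the stress tensor and of `α(V⃗_{0⁻})` at
the current — are stronger than what the source's island computation imposes: there *"the stress tensor and
conserved current are assumed in the spectrum with coefficients constrained by Ward identities"* (§4), i.e. (§2.2)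
their contribution is *"parametrized purely in terms of `C_T` and `C_J`"* — one direction of coupling space each —
and `O2WardObligations` typed that as axiom A5 (`IsWardDirected`) with the REDUCED conditions `IsPositiveForWard`
(scalar inequalities `w_Tᵀ α(V⃗_{0⁺,3,2}[g]) w_T ≥ 0`, `w_Jᵀ α(V⃗_{0⁻,2,1}[g]) w_J ≥ 0`).  This file is the
verifier-facing list for that reduced system and its assembly, item for item parallel to `O2ScanObligations`:

* §1 `WardPosT α D w_T`, `WardPosJ α D w_J` (the two scalar items) and their kernel dictionary for scan functionals
  (`wardPosT_toFunctional_iff`, `wardPosJ_toFunctional_iff`: nonnegativity of the explicit number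
  `Σ_m Σ_r w_{m r} · w ⬝ (V⃗_r(u_m, v_m) w)`); `Pos0p → WardPosT`, `Pos0m → WardPosJ` (`wardPosT_of_pos0p`, …).
* §2 `O2ObligationsWard α A D E₀ w_T w_J` — the list of `O2Obligations` with `stress_0p`, `current_0m` replaced by
  `ward_T`, `ward_J`; `isPositiveForWard_zero` (list ⇒ `IsPositiveForWard α A D 0 w_T w_J`), `isPositiveForWard`
  (with the external condition at `l`), `of_obligations` (the unreduced list serves), `of_weaker`.
* §3 the scan logic for the reduced conditions (`isPositiveForWard_of_zero_of_ext`, `boxExcludedWard_of_scan`,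
  `boxExcludedWard_of_coverTrees`, `boxExcludedWard_of_uniformCoverTrees`) and the assembled certificate shapes
  `boxExcludedWard_of_obligations`, `boxExcludedWard_of_uniformObligations` (+ `_of_weaker`), concluding
  `BoxExcludedWard A w_T w_J Q` — exclusion of the box for data satisfying A1–A5.

HONEST LIMITS.  As for `O2ScanObligations`: nothing evaluates a conformal block (items quantify over GENUINE block
families), the split at `E₀` is bookkeeping, and the Ward DIRECTIONS are parameters pinned by a certificate (the
source states their moduli, `O2WardObligations.chesterWardT/J`; componentwise signs are its convention).  RECORD of
the engines lane; no published number is touched.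

## References
* S. M. Chester et al., *Carving out OPE space and precise O(2) model critical exponents*, JHEP 06 (2020) 142,
  arXiv:1912.03324, §2.2 (Ward identities), §3.1 (functional conditions), §3.3 (Algorithm 1), §4. [cite: ChesterEtAl2020]
* D. Poland, S. Rychkov, A. Vichi, *The conformal bootstrap*, Rev. Mod. Phys. 91 (2019) 015002, §II.C eq. (19)
  (unitarity bounds). [cite: PolandRychkovVichi2019]
-/

noncomputable section

open Set Finset Matrix

namespace Literature.MathematicalPhysics.QuantumFieldTheory.O2ScanObligationsWard

open Literature.MathematicalPhysics.QuantumFieldTheory.ConformalBootstrap3D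
open O2ThreeScalarCrossing O2ThreeScalarSystem OPESpaceCoverCertificate O2OPEScanBridge O2ScanObligations
open O2WardObligations

/-! ## 1. The two scalar items and their kernel dictionary -/

section Sector

variable (α : (ℝ → ℝ → Fin 22 → ℝ) →ₗ[ℝ] ℝ) (D : Dims)

/-- The stress-tensor item with Ward-directed couplings: `w_Tᵀ α(V⃗_{0⁺,3,2}[g]) w_T ≥ 0` for every genuine block
family at `(Δ, ℓ) = (3, 2)` on the `0⁺` labels. [cite: ChesterEtAl2020, §2.2 (Ward identities), §3.1 (functional conditions)] -/
def WardPosT (wT : Fin 3 → ℝ) : Prop :=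
  ∀ g : Label → ℝ → ℝ → ℝ, GenuineOn D labels0p 3 2 g → 0 ≤ wT ⬝ᵥ (alphaMat α (V0p D g) *ᵥ wT)

/-- The current item with Ward-directed couplings: `w_Jᵀ α(V⃗_{0⁻,2,1}[g]) w_J ≥ 0` for every genuine block family at
`(Δ, ℓ) = (2, 1)` on the `0⁻` labels. [cite: ChesterEtAl2020, §2.2 (Ward identities), §3.1 (functional conditions)] -/
def WardPosJ (wJ : Fin 2 → ℝ) : Prop :=
  ∀ g : Label → ℝ → ℝ → ℝ, GenuineOn D labels0m 2 1 g → 0 ≤ wJ ⬝ᵥ (alphaMat α (V0m D g) *ᵥ wJ)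

/-- Semidefiniteness at the stress tensor gives the scalar item for any direction.
[cite: ChesterEtAl2020, §3.1 (functional conditions)] -/
theorem wardPosT_of_pos0p {α D} (h : Pos0p α D 3 2) (wT : Fin 3 → ℝ) : WardPosT α D wT := fun g hg => by
  have := (h g hg).dotProduct_mulVec_nonneg wT
  rwa [star_trivial] at this

/-- Semidefiniteness at the current gives the scalar item for any direction.
[cite: ChesterEtAl2020, §3.1 (functional conditions)] -/
theorem wardPosJ_of_pos0m {α D} (h : Pos0m α D 2 1) (wJ : Fin 2 → ℝ) : WardPosJ α D wJ := fun g hg => by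
  have := (h g hg).dotProduct_mulVec_nonneg wJ
  rwa [star_trivial] at this

end Sector

/-- The quadratic form of a finite combination of matrices is the combination of the quadratic forms.
[cite: ChesterEtAl2020, §3.1 (functional conditions)] -/
theorem dotProduct_sum_smul_mulVec {M n : ℕ} (c : Fin M → Fin 22 → ℝ)
    (N : Fin M → Fin 22 → Matrix (Fin n) (Fin n) ℝ) (w : Fin n → ℝ) :
    w ⬝ᵥ ((∑ m, ∑ r, c m r • N m r) *ᵥ w) = ∑ m, ∑ r, c m r * (w ⬝ᵥ (N m r *ᵥ w)) := by
  simp only [Matrix.sum_mulVec, Matrix.smul_mulVec, dotProduct_sum, dotProduct_smul, smul_eq_mul]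

/-- The stress-tensor item of a scan functional, spelled out: nonnegativity of the explicit number
`Σ_m Σ_r w_{m r} · w_T ⬝ (V⃗_{0⁺,r}(u_m, v_m) w_T)` for every genuine block family at `(3, 2)`.
[cite: ChesterEtAl2020, §3.1 (functional conditions), §2.2 (Ward identities)] -/
theorem wardPosT_toFunctional_iff (F : ScanFunctional) (D : Dims) (wT : Fin 3 → ℝ) :
    WardPosT F.toFunctional D wT ↔ ∀ g : Label → ℝ → ℝ → ℝ, GenuineOn D labels0p 3 2 g →
      0 ≤ ∑ m, ∑ r, F.w m r * (wT ⬝ᵥ (V0p D g (F.u m) (F.v m) r *ᵥ wT)) := by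
  simp only [WardPosT, alphaMat_toFunctional, dotProduct_sum_smul_mulVec]

/-- The current item of a scan functional, spelled out likewise. [cite: ChesterEtAl2020, §3.1 (functional conditions), §2.2 (Ward identities)] -/
theorem wardPosJ_toFunctional_iff (F : ScanFunctional) (D : Dims) (wJ : Fin 2 → ℝ) :
    WardPosJ F.toFunctional D wJ ↔ ∀ g : Label → ℝ → ℝ → ℝ, GenuineOn D labels0m 2 1 g →
      0 ≤ ∑ m, ∑ r, F.w m r * (wJ ⬝ᵥ (V0m D g (F.u m) (F.v m) r *ᵥ wJ)) := by
  simp only [WardPosJ, alphaMat_toFunctional, dotProduct_sum_smul_mulVec]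

/-- The unitarity value for scalars. [cite: PolandRychkovVichi2019, §II.C eq. (19)] -/
private theorem unitarityBound3D_zero : unitarityBound3D 0 = 1 / 2 := by
  simp [unitarityBound3D]

/-- The unitarity value for `ℓ ≠ 0`. [cite: PolandRychkovVichi2019, §II.C eq. (19)] -/
private theorem unitarityBound3D_of_ne_zero {ℓ : ℕ} (h : ℓ ≠ 0) : unitarityBound3D ℓ = (ℓ : ℝ) + 1 := by
  simp [unitarityBound3D, h]

/-! ## 2. The reduced obligation list -/

/-- **The obligations of a scan functional with Ward-directed `T` and `J`**: the list `O2Obligations α A D E₀` with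
the two semidefinite items at the stress tensor and the current replaced by the scalar items `WardPosT α D w_T`,
`WardPosJ α D w_J`. [cite: ChesterEtAl2020, §3.1 (functional conditions), §2.2 (assumptions about the spectrum; Ward identities), §4 ("coefficients constrained by Ward identities")] -/
structure O2ObligationsWard (α : (ℝ → ℝ → Fin 22 → ℝ) →ₗ[ℝ] ℝ) (A : O2Gaps) (D : Dims) (E₀ : ℝ)
    (wT : Fin 3 → ℝ) (wJ : Fin 2 → ℝ) : Prop where
  /-- (N) unit normalisation. -/
  unit_pos : UnitPos α D
  /-- (0⁺, scalars) `Δ0 ≤ Δ`, `1/2 ≤ Δ`, `Δ < E₀`. -/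
  scalar_0p : ∀ Δ : ℝ, 1 / 2 ≤ Δ → A.Δ0 ≤ Δ → Δ < E₀ → Pos0p α D Δ 0
  /-- (0⁺, T) the Ward-directed stress tensor, `(ℓ, Δ) = (2, 3)`: the scalar item. -/
  ward_T : WardPosT α D wT
  /-- (0⁺, spinning) even `ℓ ≠ 0`, from the twist threshold, below `E₀`. -/
  spinning_0p : ∀ ℓ : ℕ, Even ℓ → ℓ ≠ 0 → ∀ Δ : ℝ, (ℓ : ℝ) + 1 ≤ Δ → (ℓ : ℝ) + 1 + A.δτ ≤ Δ →
    Δ < E₀ → Pos0p α D Δ ℓ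
  /-- (0⁺, tail) even spins, `Δ ≥ E₀` above the unitarity bound. -/
  tail_0p : ∀ ℓ : ℕ, Even ℓ → ∀ Δ : ℝ, unitarityBound3D ℓ ≤ Δ → E₀ ≤ Δ → Pos0p α D Δ ℓ
  /-- (0⁻, J) the Ward-directed conserved current, `(ℓ, Δ) = (1, 2)`: the scalar item. -/
  ward_J : WardPosJ α D wJ
  /-- (0⁻, spinning) odd spins from the twist threshold, below `E₀`. -/
  spinning_0m : ∀ ℓ : ℕ, Odd ℓ → ∀ Δ : ℝ, (ℓ : ℝ) + 1 ≤ Δ → (ℓ : ℝ) + 1 + A.δτ ≤ Δ → Δ < E₀ →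
    Pos0m α D Δ ℓ
  /-- (0⁻, tail) odd spins, `Δ ≥ E₀` above the unitarity bound. -/
  tail_0m : ∀ ℓ : ℕ, Odd ℓ → ∀ Δ : ℝ, unitarityBound3D ℓ ≤ Δ → E₀ ≤ Δ → Pos0m α D Δ ℓ
  /-- (1, scalars) `Δ1 ≤ Δ`, `1/2 ≤ Δ`, `Δ < E₀`. -/
  scalar_1 : ∀ Δ : ℝ, 1 / 2 ≤ Δ → A.Δ1 ≤ Δ → Δ < E₀ → Pos1 α D Δ 0
  /-- (1, spinning) every `ℓ ≠ 0` from the twist threshold, below `E₀`. -/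
  spinning_1 : ∀ ℓ : ℕ, ℓ ≠ 0 → ∀ Δ : ℝ, (ℓ : ℝ) + 1 ≤ Δ → (ℓ : ℝ) + 1 + A.δτ ≤ Δ → Δ < E₀ →
    Pos1 α D Δ ℓ
  /-- (1, tail) every spin. -/
  tail_1 : ∀ ℓ : ℕ, ∀ Δ : ℝ, unitarityBound3D ℓ ≤ Δ → E₀ ≤ Δ → Pos1 α D Δ ℓ
  /-- (2⁺, scalars) `Δ2 ≤ Δ`, `1/2 ≤ Δ`, `Δ < E₀`. -/
  scalar_2p : ∀ Δ : ℝ, 1 / 2 ≤ Δ → A.Δ2 ≤ Δ → Δ < E₀ → Pos2p α D Δ 0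
  /-- (2⁺, spinning) even `ℓ ≠ 0` from the twist threshold, below `E₀`. -/
  spinning_2p : ∀ ℓ : ℕ, Even ℓ → ℓ ≠ 0 → ∀ Δ : ℝ, (ℓ : ℝ) + 1 ≤ Δ → (ℓ : ℝ) + 1 + A.δτ ≤ Δ →
    Δ < E₀ → Pos2p α D Δ ℓ
  /-- (2⁺, tail) even spins. -/
  tail_2p : ∀ ℓ : ℕ, Even ℓ → ∀ Δ : ℝ, unitarityBound3D ℓ ≤ Δ → E₀ ≤ Δ → Pos2p α D Δ ℓ
  /-- (2⁻, spinning) odd spins from the twist threshold, below `E₀`. -/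
  spinning_2m : ∀ ℓ : ℕ, Odd ℓ → ∀ Δ : ℝ, (ℓ : ℝ) + 1 ≤ Δ → (ℓ : ℝ) + 1 + A.δτ ≤ Δ → Δ < E₀ →
    Pos2m α D Δ ℓ
  /-- (2⁻, tail) odd spins. -/
  tail_2m : ∀ ℓ : ℕ, Odd ℓ → ∀ Δ : ℝ, unitarityBound3D ℓ ≤ Δ → E₀ ≤ Δ → Pos2m α D Δ ℓ
  /-- (3, scalars) `Δ3 ≤ Δ`, `1/2 ≤ Δ`, `Δ < E₀`. -/
  scalar_3 : ∀ Δ : ℝ, 1 / 2 ≤ Δ → A.Δ3 ≤ Δ → Δ < E₀ → Pos3 α D Δ 0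
  /-- (3, spinning) every `ℓ ≠ 0` from the twist threshold, below `E₀`. -/
  spinning_3 : ∀ ℓ : ℕ, ℓ ≠ 0 → ∀ Δ : ℝ, (ℓ : ℝ) + 1 ≤ Δ → (ℓ : ℝ) + 1 + A.δτ ≤ Δ → Δ < E₀ →
    Pos3 α D Δ ℓ
  /-- (3, tail) every spin. -/
  tail_3 : ∀ ℓ : ℕ, ∀ Δ : ℝ, unitarityBound3D ℓ ≤ Δ → E₀ ≤ Δ → Pos3 α D Δ ℓ
  /-- (4, scalars) `Δ4 ≤ Δ`, `1/2 ≤ Δ`, `Δ < E₀`. -/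
  scalar_4 : ∀ Δ : ℝ, 1 / 2 ≤ Δ → A.Δ4 ≤ Δ → Δ < E₀ → Pos4 α D Δ 0
  /-- (4, spinning) even `ℓ ≠ 0` from the twist threshold, below `E₀`. -/
  spinning_4 : ∀ ℓ : ℕ, Even ℓ → ℓ ≠ 0 → ∀ Δ : ℝ, (ℓ : ℝ) + 1 ≤ Δ → (ℓ : ℝ) + 1 + A.δτ ≤ Δ →
    Δ < E₀ → Pos4 α D Δ ℓ
  /-- (4, tail) even spins. -/
  tail_4 : ∀ ℓ : ℕ, Even ℓ → ∀ Δ : ℝ, unitarityBound3D ℓ ≤ Δ → E₀ ≤ Δ → Pos4 α D Δ ℓ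

namespace O2ObligationsWard

variable {α : (ℝ → ℝ → Fin 22 → ℝ) →ₗ[ℝ] ℝ} {A A' : O2Gaps} {D : Dims} {E₀ : ℝ} {wT : Fin 3 → ℝ}
  {wJ : Fin 2 → ℝ}

/-- The unreduced list serves the reduced one, for any directions (semidefiniteness at `T`, `J` gives the scalar
items). [cite: ChesterEtAl2020, §3.1 (functional conditions)] -/
theorem of_obligations (h : O2Obligations α A D E₀) (wT : Fin 3 → ℝ) (wJ : Fin 2 → ℝ) :
    O2ObligationsWard α A D E₀ wT wJ :=
  { unit_pos := h.unit_pos, scalar_0p := h.scalar_0p, ward_T := wardPosT_of_pos0p h.stress_0p wT,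
    spinning_0p := h.spinning_0p, tail_0p := h.tail_0p, ward_J := wardPosJ_of_pos0m h.current_0m wJ,
    spinning_0m := h.spinning_0m, tail_0m := h.tail_0m, scalar_1 := h.scalar_1, spinning_1 := h.spinning_1,
    tail_1 := h.tail_1, scalar_2p := h.scalar_2p, spinning_2p := h.spinning_2p, tail_2p := h.tail_2p,
    spinning_2m := h.spinning_2m, tail_2m := h.tail_2m, scalar_3 := h.scalar_3, spinning_3 := h.spinning_3,
    tail_3 := h.tail_3, scalar_4 := h.scalar_4, spinning_4 := h.spinning_4, tail_4 := h.tail_4 }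

/-- **The reduced list is the `l`-independent half of the reduced functional conditions**:
`O2ObligationsWard α A D E₀ w_T w_J` gives `IsPositiveForWard α A D 0 w_T w_J`.  Case analysis as in
`O2Obligations.isPositiveFor_zero`; the exact disjuncts `ℓ = 2 ∧ Δ = 3` / `ℓ = 1 ∧ Δ = 2` are excluded from the
semidefinite clauses of `IsPositiveForWard` and served by `ward_T` / `ward_J` in the scalar ones.
[cite: ChesterEtAl2020, §3.1 (functional conditions), §2.2 (assumptions about the spectrum; Ward identities)] -/
theorem isPositiveForWard_zero (h : O2ObligationsWard α A D E₀ wT wJ) : IsPositiveForWard α A D 0 wT wJ := by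
  refine ⟨h.unit_pos, fun gs gφ gt _ _ _ => by simp, ?_, h.ward_T, ?_, h.ward_J, ?_, ?_, ?_, ?_, ?_⟩
  · -- sector 0⁺ off the stress-tensor slot
    rintro Δ ℓ g ⟨hev, hb, hsc, htw⟩ hT hg
    rcases lt_or_ge Δ E₀ with hlt | hge
    · by_cases h0 : ℓ = 0
      · subst h0
        rw [unitarityBound3D_zero] at hb
        exact h.scalar_0p Δ hb (hsc rfl) hlt g hg
      · rw [unitarityBound3D_of_ne_zero h0] at hb
        rcases htw (Nat.one_le_iff_ne_zero.mpr h0) with hT' | htw'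
        · exact (hT hT').elim
        · exact h.spinning_0p ℓ hev h0 Δ hb htw' hlt g hg
    · exact h.tail_0p ℓ hev Δ hb hge g hg
  · -- sector 0⁻ off the current slot
    rintro Δ ℓ g ⟨hodd, hb, hJ⟩ hJ' hg
    rcases lt_or_ge Δ E₀ with hlt | hge
    · have h0 : ℓ ≠ 0 := by rintro rfl; exact Nat.not_odd_zero hodd
      rw [unitarityBound3D_of_ne_zero h0] at hb
      rcases hJ with hJ'' | htw'
      · exact (hJ' hJ'').elim
      · exact h.spinning_0m ℓ hodd Δ hb htw' hlt g hg
    · exact h.tail_0m ℓ hodd Δ hb hge g hg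
  · -- sector 1
    rintro Δ ℓ g ⟨hb, hsc, htw⟩ hg
    rcases lt_or_ge Δ E₀ with hlt | hge
    · by_cases h0 : ℓ = 0
      · subst h0
        rw [unitarityBound3D_zero] at hb
        exact h.scalar_1 Δ hb (hsc rfl) hlt g hg
      · rw [unitarityBound3D_of_ne_zero h0] at hb
        exact h.spinning_1 ℓ h0 Δ hb (htw (Nat.one_le_iff_ne_zero.mpr h0)) hlt g hg
    · exact h.tail_1 ℓ Δ hb hge g hg
  · -- sector 2⁺
    rintro Δ ℓ g ⟨hev, hb, hsc, htw⟩ hg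
    rcases lt_or_ge Δ E₀ with hlt | hge
    · by_cases h0 : ℓ = 0
      · subst h0
        rw [unitarityBound3D_zero] at hb
        exact h.scalar_2p Δ hb (hsc rfl) hlt g hg
      · rw [unitarityBound3D_of_ne_zero h0] at hb
        exact h.spinning_2p ℓ hev h0 Δ hb (htw (Nat.one_le_iff_ne_zero.mpr h0)) hlt g hg
    · exact h.tail_2p ℓ hev Δ hb hge g hg
  · -- sector 2⁻
    rintro Δ ℓ g ⟨hodd, hb, htw⟩ hg
    rcases lt_or_ge Δ E₀ with hlt | hge
    · have h0 : ℓ ≠ 0 := by rintro rfl; exact Nat.not_odd_zero hodd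
      rw [unitarityBound3D_of_ne_zero h0] at hb
      exact h.spinning_2m ℓ hodd Δ hb htw hlt g hg
    · exact h.tail_2m ℓ hodd Δ hb hge g hg
  · -- sector 3
    rintro Δ ℓ g ⟨hb, hsc, htw⟩ hg
    rcases lt_or_ge Δ E₀ with hlt | hge
    · by_cases h0 : ℓ = 0
      · subst h0
        rw [unitarityBound3D_zero] at hb
        exact h.scalar_3 Δ hb (hsc rfl) hlt g hg
      · rw [unitarityBound3D_of_ne_zero h0] at hb
        exact h.spinning_3 ℓ h0 Δ hb (htw (Nat.one_le_iff_ne_zero.mpr h0)) hlt g hg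
    · exact h.tail_3 ℓ Δ hb hge g hg
  · -- sector 4
    rintro Δ ℓ g ⟨hev, hb, hsc, htw⟩ hg
    rcases lt_or_ge Δ E₀ with hlt | hge
    · by_cases h0 : ℓ = 0
      · subst h0
        rw [unitarityBound3D_zero] at hb
        exact h.scalar_4 Δ hb (hsc rfl) hlt g hg
      · rw [unitarityBound3D_of_ne_zero h0] at hb
        exact h.spinning_4 ℓ hev h0 Δ hb (htw (Nat.one_le_iff_ne_zero.mpr h0)) hlt g hg
    · exact h.tail_4 ℓ hev Δ hb hge g hg

/-- Monotonicity in the assumptions: a reduced list against `A` serves every `A'` with `A.Weaker A'`.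
[cite: ChesterEtAl2020, §2.2 (assumptions about the spectrum)] -/
theorem of_weaker (h : O2ObligationsWard α A D E₀ wT wJ) (hw : A.Weaker A') :
    O2ObligationsWard α A' D E₀ wT wJ := by
  obtain ⟨h0, h1, h2, h3, h4, hτ⟩ := hw
  have hτ' : ∀ (ℓ : ℕ) (Δ : ℝ), (ℓ : ℝ) + 1 + A'.δτ ≤ Δ → (ℓ : ℝ) + 1 + A.δτ ≤ Δ :=
    fun ℓ Δ hΔ => le_trans (by linarith) hΔ
  exact
    { unit_pos := h.unit_pos
      scalar_0p := fun Δ hb hΔ hlt => h.scalar_0p Δ hb (h0.trans hΔ) hlt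
      ward_T := h.ward_T
      spinning_0p := fun ℓ hev hℓ Δ hb htw hlt => h.spinning_0p ℓ hev hℓ Δ hb (hτ' ℓ Δ htw) hlt
      tail_0p := h.tail_0p
      ward_J := h.ward_J
      spinning_0m := fun ℓ ho Δ hb htw hlt => h.spinning_0m ℓ ho Δ hb (hτ' ℓ Δ htw) hlt
      tail_0m := h.tail_0m
      scalar_1 := fun Δ hb hΔ hlt => h.scalar_1 Δ hb (h1.trans hΔ) hlt
      spinning_1 := fun ℓ hℓ Δ hb htw hlt => h.spinning_1 ℓ hℓ Δ hb (hτ' ℓ Δ htw) hlt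
      tail_1 := h.tail_1
      scalar_2p := fun Δ hb hΔ hlt => h.scalar_2p Δ hb (h2.trans hΔ) hlt
      spinning_2p := fun ℓ hev hℓ Δ hb htw hlt => h.spinning_2p ℓ hev hℓ Δ hb (hτ' ℓ Δ htw) hlt
      tail_2p := h.tail_2p
      spinning_2m := fun ℓ ho Δ hb htw hlt => h.spinning_2m ℓ ho Δ hb (hτ' ℓ Δ htw) hlt
      tail_2m := h.tail_2m
      scalar_3 := fun Δ hb hΔ hlt => h.scalar_3 Δ hb (h3.trans hΔ) hlt
      spinning_3 := fun ℓ hℓ Δ hb htw hlt => h.spinning_3 ℓ hℓ Δ hb (hτ' ℓ Δ htw) hlt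
      tail_3 := h.tail_3
      scalar_4 := fun Δ hb hΔ hlt => h.scalar_4 Δ hb (h4.trans hΔ) hlt
      spinning_4 := fun ℓ hev hℓ Δ hb htw hlt => h.spinning_4 ℓ hev hℓ Δ hb (hτ' ℓ Δ htw) hlt
      tail_4 := h.tail_4 }

end O2ObligationsWard

/-! ## 3. The scan logic and the assembled certificate shapes for the reduced conditions -/

section Scan
variable {A A' : O2Gaps} {Q : Set (ℝ × ℝ × ℝ)} {wT : Dims → Fin 3 → ℝ} {wJ : Dims → Fin 2 → ℝ}

/-- `IsPositiveForWard` at a class `l` from its `l`-independent part and the external condition at `l`.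
[cite: ChesterEtAl2020, §3.1 (functional conditions), §3.2 (weaker condition)] -/
theorem isPositiveForWard_of_zero_of_ext {α : (ℝ → ℝ → Fin 22 → ℝ) →ₗ[ℝ] ℝ} {D : Dims} {wT' : Fin 3 → ℝ}
    {wJ' : Fin 2 → ℝ} (h0 : IsPositiveForWard α A D 0 wT' wJ') {l : Fin 4 → ℝ} (hext : ExtNonnegAt α D l) :
    IsPositiveForWard α A D l wT' wJ' :=
  ⟨h0.1, hext, h0.2.2⟩

/-- With the external condition at a class `l` the reduced list gives the reduced functional conditions there.
[cite: ChesterEtAl2020, §3.1 (functional conditions), §3.2 (weaker condition)] -/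
theorem O2ObligationsWard.isPositiveForWard {α : (ℝ → ℝ → Fin 22 → ℝ) →ₗ[ℝ] ℝ} {D : Dims} {E₀ : ℝ}
    {wT' : Fin 3 → ℝ} {wJ' : Fin 2 → ℝ} (h : O2ObligationsWard α A D E₀ wT' wJ') {l : Fin 4 → ℝ}
    (hext : ExtNonnegAt α D l) : IsPositiveForWard α A D l wT' wJ' :=
  isPositiveForWard_of_zero_of_ext h.isPositiveForWard_zero hext

/-- **Box exclusion under A1–A5 from a scan at every point of the box**: finitely many scan functionals with the
reduced `l`-independent conditions, every class `l ≠ 0` served by one of them.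
[cite: ChesterEtAl2020, §3.3 (allowed and disallowed points; Algorithm 1), §2.2 (Ward identities)] -/
theorem boxExcludedWard_of_scan (ι : Dims → Type*) (F : ∀ D, ι D → ScanFunctional)
    (hcore : ∀ D : Dims, (D.Δs, D.Δφ, D.Δt) ∈ Q →
      ∀ k, IsPositiveForWard (F D k).toFunctional A D 0 (wT D) (wJ D))
    (hscan : ∀ D : Dims, (D.Δs, D.Δφ, D.Δt) ∈ Q →
      ∀ l : Fin 4 → ℝ, l ≠ 0 → ∃ k, ExtNonnegAt (F D k).toFunctional D l) :
    BoxExcludedWard A wT wJ Q := by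
  refine boxExcludedWard_of_pointFunctionals fun D hD l hl => ?_
  obtain ⟨k, hk⟩ := hscan D hD l hl
  exact ⟨(F D k).M, (F D k).w, (F D k).z, (F D k).zb, (F D k).hz, (F D k).hzb,
    isPositiveForWard_of_zero_of_ext (hcore D hD k) hk⟩

/-- **Box exclusion under A1–A5 from certified box-trees** (data may depend on the point `D`).
[cite: ChesterEtAl2020, §3.3 (Algorithm 1), §3.4, §2.2 (Ward identities)] -/
theorem boxExcludedWard_of_coverTrees (ι : Dims → Type*) (F : ∀ D, ι D → ScanFunctional)
    (Blo Bhi : ∀ D, ι D → Matrix (Fin 4) (Fin 4) ℝ) (T : ∀ D, Fin 4 → CoverTree (ι D) 4)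
    (hcore : ∀ D : Dims, (D.Δs, D.Δφ, D.Δt) ∈ Q →
      ∀ k, IsPositiveForWard (F D k).toFunctional A D 0 (wT D) (wJ D))
    (henc : ∀ D : Dims, (D.Δs, D.Δφ, D.Δt) ∈ Q →
      ∀ k, ExtEnclosed (F D k).toFunctional D (Blo D k) (Bhi D k))
    (hT : ∀ D : Dims, (D.Δs, D.Δφ, D.Δt) ∈ Q → ∀ i : Fin 4,
      (T D i).Certifies (intervalVertexTest (Blo D) (Bhi D)) (facetLo i) (fun _ => (1 : ℝ))) :
    BoxExcludedWard A wT wJ Q :=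
  boxExcludedWard_of_scan ι F hcore fun D hD =>
    scan_of_robustlyExhausted (fun k => (F D k).toFunctional) (Blo D) (Bhi D) (henc D hD)
      (robustlyExhausted_of_coverTrees (Blo D) (Bhi D) (T D) (hT D hD))

/-- **Uniform certificate for a box under A1–A5**: ONE functional list, ONE family of enclosures, FOUR trees.
[cite: ChesterEtAl2020, §3.3 (Algorithm 1), §3.4, §2.2 (Ward identities)] -/
theorem boxExcludedWard_of_uniformCoverTrees {ι : Type*} (F : ι → ScanFunctional)
    (Blo Bhi : ι → Matrix (Fin 4) (Fin 4) ℝ) (T : Fin 4 → CoverTree ι 4)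
    (hcore : ∀ D : Dims, (D.Δs, D.Δφ, D.Δt) ∈ Q →
      ∀ k, IsPositiveForWard (F k).toFunctional A D 0 (wT D) (wJ D))
    (henc : ∀ D : Dims, (D.Δs, D.Δφ, D.Δt) ∈ Q → ∀ k, ExtEnclosed (F k).toFunctional D (Blo k) (Bhi k))
    (hT : ∀ i : Fin 4, (T i).Certifies (intervalVertexTest Blo Bhi) (facetLo i) (fun _ => (1 : ℝ))) :
    BoxExcludedWard A wT wJ Q :=
  boxExcludedWard_of_coverTrees (fun _ => ι) (fun _ => F) (fun _ => Blo) (fun _ => Bhi) (fun _ => T) hcore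
    henc fun _ _ => hT

/-- **Box exclusion under A1–A5 from reduced obligation lists** (data depending on the point `D ∈ Q`).
[cite: ChesterEtAl2020, §3.3 (allowed and disallowed points; Algorithm 1), §3.1, §2.2 (Ward identities)] -/
theorem boxExcludedWard_of_obligations (ι : Dims → Type*) (F : ∀ D, ι D → ScanFunctional)
    (E₀ : ∀ D, ι D → ℝ) (Blo Bhi : ∀ D, ι D → Matrix (Fin 4) (Fin 4) ℝ) (T : ∀ D, Fin 4 → CoverTree (ι D) 4)
    (hobl : ∀ D : Dims, (D.Δs, D.Δφ, D.Δt) ∈ Q →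
      ∀ k, O2ObligationsWard (F D k).toFunctional A D (E₀ D k) (wT D) (wJ D))
    (henc : ∀ D : Dims, (D.Δs, D.Δφ, D.Δt) ∈ Q →
      ∀ k, ExtEnclosed (F D k).toFunctional D (Blo D k) (Bhi D k))
    (hT : ∀ D : Dims, (D.Δs, D.Δφ, D.Δt) ∈ Q → ∀ i : Fin 4,
      (T D i).Certifies (intervalVertexTest (Blo D) (Bhi D)) (facetLo i) (fun _ => (1 : ℝ))) :
    BoxExcludedWard A wT wJ Q :=
  boxExcludedWard_of_coverTrees ι F Blo Bhi T (fun D hD k => (hobl D hD k).isPositiveForWard_zero) henc hT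

/-- **Uniform certificate for a box under A1–A5** from ONE list of scan functionals whose reduced obligation lists
are discharged at every point of `Q`. [cite: ChesterEtAl2020, §3.3 (allowed and disallowed points; Algorithm 1), §3.1, §2.2 (Ward identities)] -/
theorem boxExcludedWard_of_uniformObligations {ι : Type*} (F : ι → ScanFunctional) (E₀ : ι → ℝ)
    (Blo Bhi : ι → Matrix (Fin 4) (Fin 4) ℝ) (T : Fin 4 → CoverTree ι 4)
    (hobl : ∀ D : Dims, (D.Δs, D.Δφ, D.Δt) ∈ Q →
      ∀ k, O2ObligationsWard (F k).toFunctional A D (E₀ k) (wT D) (wJ D))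
    (henc : ∀ D : Dims, (D.Δs, D.Δφ, D.Δt) ∈ Q → ∀ k, ExtEnclosed (F k).toFunctional D (Blo k) (Bhi k))
    (hT : ∀ i : Fin 4, (T i).Certifies (intervalVertexTest Blo Bhi) (facetLo i) (fun _ => (1 : ℝ))) :
    BoxExcludedWard A wT wJ Q :=
  boxExcludedWard_of_uniformCoverTrees F Blo Bhi T (fun D hD k => (hobl D hD k).isPositiveForWard_zero) henc hT

/-- Monotonicity of `BoxExcludedWard` in the assumptions. [cite: ChesterEtAl2020, §2.2 (assumptions about the spectrum)] -/
theorem boxExcludedWard_of_weaker (h : BoxExcludedWard A wT wJ Q) (hw : A.Weaker A') : BoxExcludedWard A' wT wJ Q :=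
  fun X hX => h X ⟨hX.1.of_weaker hw, hX.2⟩

/-- Exclusion under assumptions `A'` (with A5) from a reduced certificate against WEAKER assumptions `A`.
[cite: ChesterEtAl2020, §2.2 (assumptions about the spectrum), §4.1 (gap assumptions)] -/
theorem boxExcludedWard_of_uniformObligations_of_weaker {ι : Type*} (hw : A.Weaker A') (F : ι → ScanFunctional)
    (E₀ : ι → ℝ) (Blo Bhi : ι → Matrix (Fin 4) (Fin 4) ℝ) (T : Fin 4 → CoverTree ι 4)
    (hobl : ∀ D : Dims, (D.Δs, D.Δφ, D.Δt) ∈ Q →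
      ∀ k, O2ObligationsWard (F k).toFunctional A D (E₀ k) (wT D) (wJ D))
    (henc : ∀ D : Dims, (D.Δs, D.Δφ, D.Δt) ∈ Q → ∀ k, ExtEnclosed (F k).toFunctional D (Blo k) (Bhi k))
    (hT : ∀ i : Fin 4, (T i).Certifies (intervalVertexTest Blo Bhi) (facetLo i) (fun _ => (1 : ℝ))) :
    BoxExcludedWard A' wT wJ Q :=
  boxExcludedWard_of_weaker (boxExcludedWard_of_uniformObligations F E₀ Blo Bhi T hobl henc hT) hw

end Scan

end Literature.MathematicalPhysics.QuantumFieldTheory.O2ScanObligationsWard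

end
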